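import Mathlib
import HarnessLib
import Literature.Geometry.Lorentzian.KillingFlowIsometry
import Literature.Geometry.Lorentzian.KillingAlgebraAsymptoticallyFlatProofs
import Literature.Geometry.Lorentzian.EinsteinTensorNaturality
import Literature.Geometry.Lorentzian.MetricValCongr
import Literature.Geometry.Lorentzian.LeviCivitaProofs
import Literature.Geometry.Lorentzian.IsometryProofs

/-!
# Transport of local Killing continuations by the stationary isometries (crux
# `NonTrappingHawkingRigidity`, stmt-FinalStateConjecture-13896, line `Sketch`, stub S3 helper)

Helper for the slab patching (stub S3 `stub_slabPatching`): the flow maps `φ_t = θ(t, ·)` of a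
complete Killing field `T` with a smooth global flow `θ` (group law; isometries,
`KillingFlowIsometry.lean`) transport an ADMISSIBLE PAIR `(W, K)` — `W` an open subset of the
d.o.c. which is a `Y`-saturated box over the level `c` of a flow-invariant function `f`, `K` a
local `T`-commuting Killing field on `W` agreeing with `L` on `W ∩ {f < c}` — to the admissible
pair `(φ_t(W), (φ_t)_* K)`, `(φ_t)_* K = φ_{-t}^* K` (`VectorField.mpullback` along `φ_{-t}`),
provided `Y` and (on `{f < c}`) `L` are invariant under the flow
(`stub_slabPatching_transport`). Ingredients: the differentials `dφ_t` are invertible with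
inverse `dφ_{-t}` (`mfderiv_flow_neg_apply_mfderiv_flow`); the Killing equation is natural under
the isometry `φ_{-t}` (`val_leviCivita_mpullback_add` for the pullback metric `φ_{-t}^* g`, which
has the same values as `g`, hence the same Levi-Civita connection, `leviCivita_congr_of_val_eq`);
the bracket is natural (`mpullback_mlieBracket`) and `φ_{-t}^* T = T` (`mfderiv_flow_apply_eq`);
integral curves of the invariant field `Y` are mapped to integral curves. Everything is proved;
no definitions. O'Neill 1983, Ch. 9, Prop. 9.23; Lee 2012, Thm. 9.42.
-/

noncomputable section

-- D-0017: single-problem summit, `Summit.<S>.<S>.…` by design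
set_option linter.dupNamespace false

namespace Summit.FinalStateConjecture.FinalStateConjecture.Theorems.NonTrappingHawkingRigidity.AzimuthalPartialAnalyticity.SlabPatching

open Set Filter Function Bundle VectorField Literature.Geometry.Lorentzian
open scoped Manifold ContDiff Topology

section General

variable {E : Type*} [NormedAddCommGroup E] [NormedSpace ℝ E]
  {M : Type*} [TopologicalSpace M] [ChartedSpace E M] {θ : ℝ × M → M}

/-- For a `C²` flow with the group law, `dφ_{-t}|_y` is invertible with inverse
`dφ_t|_{φ_{-t} y}` (`mfderiv_flow_neg_apply_mfderiv_flow` both ways). Lee 2012, Thm. 9.12.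
[cite: LeeSmoothManifolds2013, Thm. 9.12] -/
theorem inverse_mfderiv_flow_neg (hθ : ContMDiff (𝓘(ℝ, ℝ).prod 𝓘(ℝ, E)) 𝓘(ℝ, E) 2 θ)
    (hθ0 : ∀ p, θ (0, p) = p) (hθadd : ∀ t s p, θ (t, θ (s, p)) = θ (t + s, p)) (t : ℝ) (y : M) :
    (mfderiv 𝓘(ℝ, E) 𝓘(ℝ, E) (fun q ↦ θ (-t, q)) y).IsInvertible ∧
      (mfderiv 𝓘(ℝ, E) 𝓘(ℝ, E) (fun q ↦ θ (-t, q)) y).inverse =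
        (mfderiv 𝓘(ℝ, E) 𝓘(ℝ, E) (fun q ↦ θ (t, q)) (θ (-t, y)) :
          TangentSpace 𝓘(ℝ, E) (θ (-t, y)) →L[ℝ] TangentSpace 𝓘(ℝ, E) y) := by
  set B : TangentSpace 𝓘(ℝ, E) (θ (-t, y)) →L[ℝ] TangentSpace 𝓘(ℝ, E) y :=
    mfderiv 𝓘(ℝ, E) 𝓘(ℝ, E) (fun q ↦ θ (t, q)) (θ (-t, y)) with hB
  have h1 : B.comp (mfderiv 𝓘(ℝ, E) 𝓘(ℝ, E) (fun q ↦ θ (-t, q)) y) =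
      ContinuousLinearMap.id ℝ (TangentSpace 𝓘(ℝ, E) y) := by
    ext v
    have h := PseudoRiemannianMetric.mfderiv_flow_neg_apply_mfderiv_flow hθ hθ0 hθadd (-t) y v
    rw [neg_neg] at h
    exact h
  have h2 : (mfderiv 𝓘(ℝ, E) 𝓘(ℝ, E) (fun q ↦ θ (-t, q)) y).comp B =
      ContinuousLinearMap.id ℝ (TangentSpace 𝓘(ℝ, E) (θ (-t, y))) := by
    ext w
    have h := PseudoRiemannianMetric.mfderiv_flow_neg_apply_mfderiv_flow hθ hθ0 hθadd t
      (θ (-t, y)) w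
    have hy : θ (t, θ (-t, y)) = y := flow_apply_flow_neg hθ0 hθadd t y
    rw [hy] at h
    exact h
  exact ⟨ContinuousLinearMap.IsInvertible.of_inverse h2 h1, ContinuousLinearMap.inverse_eq h2 h1⟩

/-- The pushed-forward field `(φ_t)_* K = φ_{-t}^* K` at `y` is `dφ_t (K (φ_{-t} y))`. [folklore] -/
theorem mpullback_flow_neg_apply (hθ : ContMDiff (𝓘(ℝ, ℝ).prod 𝓘(ℝ, E)) 𝓘(ℝ, E) 2 θ)
    (hθ0 : ∀ p, θ (0, p) = p) (hθadd : ∀ t s p, θ (t, θ (s, p)) = θ (t + s, p))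
    (K : Π x : M, TangentSpace 𝓘(ℝ, E) x) (t : ℝ) (y : M) :
    mpullback 𝓘(ℝ, E) 𝓘(ℝ, E) (fun q ↦ θ (-t, q)) K y =
      mfderiv 𝓘(ℝ, E) 𝓘(ℝ, E) (fun q ↦ θ (t, q)) (θ (-t, y)) (K (θ (-t, y))) := by
  rw [mpullback_apply, (inverse_mfderiv_flow_neg hθ hθ0 hθadd t y).2]
  rfl

/-- **A flow maps integral curves of an invariant field to integral curves**: if
`dφ_t (Y x) = Y (φ_t x)` at the points of `O` and `γ` is an integral curve of `Y` on an open
interval staying in `O`, then `φ_t ∘ γ` is an integral curve of `Y` there. Lee 2012, Prop. 9.13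
/ Thm. 9.42. [cite: LeeSmoothManifolds2013, Thm. 9.42] -/
theorem isMIntegralCurveOn_flow_comp (hθ : ContMDiff (𝓘(ℝ, ℝ).prod 𝓘(ℝ, E)) 𝓘(ℝ, E) 2 θ)
    {O : Set M} {Y : Π x : M, TangentSpace 𝓘(ℝ, E) x} (t : ℝ)
    (hYinv : ∀ p ∈ O, mfderiv 𝓘(ℝ, E) 𝓘(ℝ, E) (fun q ↦ θ (t, q)) p (Y p) = Y (θ (t, p)))
    {γ : ℝ → M} {a b : ℝ} (hγ : IsMIntegralCurveOn γ Y (Ioo a b)) (hγO : ∀ s ∈ Ioo a b, γ s ∈ O) :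
    IsMIntegralCurveOn ((fun q ↦ θ (t, q)) ∘ γ) Y (Ioo a b) := by
  intro s hs
  have hγs : HasMFDerivAt 𝓘(ℝ, ℝ) 𝓘(ℝ, E) γ s ((1 : ℝ →L[ℝ] ℝ).smulRight (Y (γ s))) :=
    (hγ s hs).hasMFDerivAt (isOpen_Ioo.mem_nhds hs)
  have hd := PseudoRiemannianMetric.mdifferentiableAt_flow hθ t (γ s)
  have h := hd.hasMFDerivAt.comp s hγs
  have heq : (mfderiv 𝓘(ℝ, E) 𝓘(ℝ, E) (fun q ↦ θ (t, q)) (γ s)).comp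
      ((1 : ℝ →L[ℝ] ℝ).smulRight (Y (γ s))) =
      (1 : ℝ →L[ℝ] ℝ).smulRight (Y (θ (t, γ s))) := by
    apply ContinuousLinearMap.ext_ring
    simp only [ContinuousLinearMap.comp_apply, ContinuousLinearMap.smulRight_apply,
      one_apply_eq_self, one_smul]
    exact hYinv _ (hγO s hs)
  exact (h.congr_mfderiv heq).hasMFDerivWithinAt

variable [CompleteSpace E] [IsManifold 𝓘(ℝ, E) ∞ M] [T2Space M]

variable [FiniteDimensional ℝ E]
  (g : PseudoRiemannianMetric 𝓘(ℝ, E) ∞ E (TangentSpace 𝓘(ℝ, E) : M → Type _)) [g.HasLeviCivita]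

omit [T2Space M] in
/-- **The Killing equation is transported by the isometric flow maps.** If every `φ_s` is an
infinitesimal isometry of `g` and `K` is `C^∞` near `φ_{-t} y` and satisfies the Killing equation
there, then `(φ_t)_* K = φ_{-t}^* K` satisfies the Killing equation at `y`: the pullback metric
`φ_{-t}^* g` has the same values as `g` (isometry), hence the same Levi-Civita connection
(`leviCivita_congr_of_val_eq`), and the Killing equation is natural for pullbacks
(`val_leviCivita_mpullback_add`). O'Neill 1983, Ch. 9, Prop. 9.23 with Prop. 9.25 and Ch. 3,
Prop. 3.59. [cite: ONeill1983, Ch. 9, Prop. 9.25] -/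
theorem killing_mpullback_flow_neg (hθ : ContMDiff (𝓘(ℝ, ℝ).prod 𝓘(ℝ, E)) 𝓘(ℝ, E) ∞ θ)
    (hθ0 : ∀ p, θ (0, p) = p) (hθadd : ∀ t s p, θ (t, θ (s, p)) = θ (t + s, p))
    (hiso : ∀ (s : ℝ) (p : M) (v w : TangentSpace 𝓘(ℝ, E) p),
      g.val (θ (s, p)) (mfderiv 𝓘(ℝ, E) 𝓘(ℝ, E) (fun q ↦ θ (s, q)) p v)
        (mfderiv 𝓘(ℝ, E) 𝓘(ℝ, E) (fun q ↦ θ (s, q)) p w) = g.val p v w)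
    {K : Π x : M, TangentSpace 𝓘(ℝ, E) x} (t : ℝ) {y : M}
    (hKs : ContMDiffAt 𝓘(ℝ, E) (𝓘(ℝ, E).prod 𝓘(ℝ, E)) ∞
      (fun x ↦ (TotalSpace.mk' E x (K x) : TangentBundle 𝓘(ℝ, E) M)) (θ (-t, y)))
    (hKk : ∀ v w : TangentSpace 𝓘(ℝ, E) (θ (-t, y)),
      g.val (θ (-t, y)) (g.leviCivita K (θ (-t, y)) v) w +
        g.val (θ (-t, y)) v (g.leviCivita K (θ (-t, y)) w) = 0)
    (v w : TangentSpace 𝓘(ℝ, E) y) :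
    g.val y (g.leviCivita (mpullback 𝓘(ℝ, E) 𝓘(ℝ, E) (fun q ↦ θ (-t, q)) K) y v) w +
      g.val y v (g.leviCivita (mpullback 𝓘(ℝ, E) 𝓘(ℝ, E) (fun q ↦ θ (-t, q)) K) y w) = 0 := by
  set Φ : M → M := fun q ↦ θ (-t, q) with hΦ
  have hθ2 : ContMDiff (𝓘(ℝ, ℝ).prod 𝓘(ℝ, E)) 𝓘(ℝ, E) 2 θ :=
    hθ.of_le (ENat.LEInfty.out : (2 : ℕ∞ω) ≤ ∞)
  have hΦs : ContMDiff 𝓘(ℝ, E) 𝓘(ℝ, E) (∞ + 1) Φ := by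
    have h : ((∞ : ℕ∞ω) + 1) = ∞ := rfl
    rw [h]
    exact hθ.comp (contMDiff_const.prodMk contMDiff_id)
  have hΦ' : ∀ u, Function.Injective (mfderiv 𝓘(ℝ, E) 𝓘(ℝ, E) Φ u) := fun u ↦
    (inverse_mfderiv_flow_neg hθ2 hθ0 hθadd t u).1.injective
  have hdim : Module.finrank ℝ E = Module.finrank ℝ E := rfl
  have hpb : PseudoRiemannianMetric.contMDiff_pullbackBilin 𝓘(ℝ, E) M 𝓘(ℝ, E) M ∞ :=
    PseudoRiemannianMetric.contMDiff_pullbackBilin_holds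
  haveI := (g.comap hpb Φ hΦs hΦ' hdim).hasLeviCivita
  -- the pullback metric has the same values as `g`
  have hval : ∀ x, (g.comap hpb Φ hΦs hΦ' hdim).val x = g.val x := by
    intro x
    ext a b
    rw [PseudoRiemannianMetric.val_comap, pullbackBilin_apply]
    exact hiso (-t) x a b
  have hlc : (g.comap hpb Φ hΦs hΦ' hdim).leviCivita = g.leviCivita :=
    PseudoRiemannianMetric.leviCivita_congr_of_val_eq hval
  have hKd : MDiffAt (T% K) (Φ y) := hKs.mdifferentiableAt (by simp)
  have key := g.val_leviCivita_mpullback_add hpb hΦs hΦ' hdim hKd v w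
  rw [hval y, hlc] at key
  rw [key]
  exact hKk _ _

omit [FiniteDimensional ℝ E] in
/-- **The bracket with the generating field is transported**: if `[T, K] = 0` at `φ_{-t} y` (with
`K` differentiable there and `T` a `C^∞` field with flow `θ`), then `[T, φ_{-t}^* K] (y) = 0`:
`φ_{-t}^* T = T` (invariance of `T` under its own flow, `mfderiv_flow_apply_eq`) and naturality of
the bracket (`mpullback_mlieBracket`). Lee 2012, Thm. 9.42 and Prop. 8.30 (naturality).
[cite: LeeSmoothManifolds2013, Thm. 9.42] -/
theorem mlieBracket_mpullback_flow_neg {T : Π x : M, TangentSpace 𝓘(ℝ, E) x}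
    (hT : ContMDiff 𝓘(ℝ, E) 𝓘(ℝ, E).tangent ∞ (fun x ↦ (⟨x, T x⟩ : TangentBundle 𝓘(ℝ, E) M)))
    (hθ : ContMDiff (𝓘(ℝ, ℝ).prod 𝓘(ℝ, E)) 𝓘(ℝ, E) ∞ θ)
    (hθ0 : ∀ p, θ (0, p) = p) (hθadd : ∀ t s p, θ (t, θ (s, p)) = θ (t + s, p))
    (hθT : ∀ p, IsMIntegralCurve (fun t ↦ θ (t, p)) T)
    {K : Π x : M, TangentSpace 𝓘(ℝ, E) x} (t : ℝ) {y : M}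
    (hKs : ContMDiffAt 𝓘(ℝ, E) (𝓘(ℝ, E).prod 𝓘(ℝ, E)) ∞
      (fun x ↦ (TotalSpace.mk' E x (K x) : TangentBundle 𝓘(ℝ, E) M)) (θ (-t, y)))
    (hKb : mlieBracket 𝓘(ℝ, E) T K (θ (-t, y)) = 0) :
    mlieBracket 𝓘(ℝ, E) T (mpullback 𝓘(ℝ, E) 𝓘(ℝ, E) (fun q ↦ θ (-t, q)) K) y = 0 := by
  set Φ : M → M := fun q ↦ θ (-t, q) with hΦ
  have hθ2 : ContMDiff (𝓘(ℝ, ℝ).prod 𝓘(ℝ, E)) 𝓘(ℝ, E) 2 θ :=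
    hθ.of_le (ENat.LEInfty.out : (2 : ℕ∞ω) ≤ ∞)
  have hΦs : ContMDiff 𝓘(ℝ, E) 𝓘(ℝ, E) ∞ Φ := hθ.comp (contMDiff_const.prodMk contMDiff_id)
  -- `Φ^* T = T`
  have hTinv : mpullback 𝓘(ℝ, E) 𝓘(ℝ, E) Φ T = T := by
    funext x
    rw [mpullback_flow_neg_apply hθ2 hθ0 hθadd T t x]
    have h := mfderiv_flow_apply_eq hT hT (fun z ↦ by simp) hθ2 hθT hθ0 hθadd t (θ (-t, x))
    rw [h, flow_apply_flow_neg hθ0 hθadd]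
  haveI : IsManifold 𝓘(ℝ, E) (minSmoothness ℝ 2) M := by
    rw [minSmoothness_of_isRCLikeNormedField]
    infer_instance
  have key := mpullback_mlieBracket (I := 𝓘(ℝ, E)) (I' := 𝓘(ℝ, E)) (f := Φ) (V := T) (W := K)
    (x₀ := y) ((hT _).mdifferentiableAt (by simp)) (hKs.mdifferentiableAt (by simp)) (hΦs y)
    (by rw [minSmoothness_of_isRCLikeNormedField]; exact (ENat.LEInfty.out : (2 : ℕ∞ω) ≤ ∞))
  rw [hTinv] at key
  rw [← key, mpullback_apply]
  change (mfderiv 𝓘(ℝ, E) 𝓘(ℝ, E) Φ y).inverse (mlieBracket 𝓘(ℝ, E) T K (θ (-t, y))) = 0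
  rw [hKb, map_zero]

end General

section BlackHole

/-- **Registered form (sub-goal `stub_slabPatching_transport` of stub S3 `stub_slabPatching`):
transport of admissible pairs by the stationary isometries.** Let `θ` be a smooth global flow of
`T = 𝓑.killing` with the group law, consisting of infinitesimal isometries and preserving the
d.o.c. (`StationaryAFBlackHole.exists_stationary_flow`), let `f` be flow-invariant on the d.o.c.,
`Y` a flow-invariant field on the d.o.c. and `L` a flow-invariant field on `{f < c} ∩ doc`. If
`(W, K)` is ADMISSIBLE — `W ⊆ doc` open and `Y`-saturated over the level `c`, `K` a local
`T`-commuting Killing field on `W` with `K = L` on `W ∩ {f < c}` — then so is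
`(φ_t(W), φ_{-t}^* K)`. [cite: ONeill1983, Ch. 9, Prop. 9.25] -/
theorem stub_slabPatching_transport :
    ∀ (𝓑 : StationaryAFBlackHole.{0}) [𝓑.metric.HasLeviCivita],
      ∀ (θ : ℝ × 𝓑.carrier → 𝓑.carrier) (f : 𝓑.carrier → ℝ) (c t : ℝ)
        (Y L K : Π x : 𝓑.carrier, TangentSpace (𝓡 4) x) (W : Set 𝓑.carrier),
      ContMDiff (𝓘(ℝ, ℝ).prod (𝓡 4)) (𝓡 4) ((⊤ : ℕ∞) : WithTop ℕ∞) θ →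
      (∀ p, θ (0, p) = p) → (∀ t s p, θ (t, θ (s, p)) = θ (t + s, p)) →
      (∀ p, IsMIntegralCurve (fun t ↦ θ (t, p)) 𝓑.killing) →
      (∀ (s : ℝ) (p : 𝓑.carrier) (v w : TangentSpace (𝓡 4) p),
        𝓑.metric.val (θ (s, p)) (mfderiv (𝓡 4) (𝓡 4) (fun q ↦ θ (s, q)) p v)
          (mfderiv (𝓡 4) (𝓡 4) (fun q ↦ θ (s, q)) p w) = 𝓑.metric.val p v w) →
      (∀ p ∈ 𝓑.doc, ∀ s : ℝ, θ (s, p) ∈ 𝓑.doc) →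
      (∀ p ∈ 𝓑.doc, ∀ s : ℝ, f (θ (s, p)) = f p) →
      (∀ p ∈ 𝓑.doc, ∀ s : ℝ, mfderiv (𝓡 4) (𝓡 4) (fun q ↦ θ (s, q)) p (Y p) = Y (θ (s, p))) →
      (∀ p ∈ {x | x ∈ 𝓑.doc ∧ f x < c}, ∀ s : ℝ,
        mfderiv (𝓡 4) (𝓡 4) (fun q ↦ θ (s, q)) p (L p) = L (θ (s, p))) →
      (IsOpen W ∧ W ⊆ 𝓑.doc ∧
        (∀ x ∈ W, c ≤ f x → ∃ (γ : ℝ → 𝓑.carrier) (a a' b' : ℝ), a' < a ∧ a < 0 ∧ 0 < b' ∧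
          γ 0 = x ∧ IsMIntegralCurveOn γ Y (Set.Ioo a' b') ∧ (∀ s ∈ Set.Ioo a' b', γ s ∈ W) ∧
          f (γ a) < c) ∧
        ContMDiffOn (𝓡 4) ((𝓡 4).prod 𝓘(ℝ, E4)) ((⊤ : ℕ∞) : WithTop ℕ∞)
          (fun x ↦ (Bundle.TotalSpace.mk' E4 x (K x) : TangentBundle (𝓡 4) 𝓑.carrier)) W ∧
        (∀ x ∈ W, ∀ v w : TangentSpace (𝓡 4) x,
          𝓑.metric.val x (𝓑.metric.leviCivita K x v) w +
            𝓑.metric.val x v (𝓑.metric.leviCivita K x w) = 0) ∧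
        (∀ x ∈ W, VectorField.mlieBracket (𝓡 4) 𝓑.killing K x = 0) ∧
        ∀ x ∈ W, f x < c → K x = L x) →
      IsOpen ((fun q ↦ θ (t, q)) '' W) ∧ (fun q ↦ θ (t, q)) '' W ⊆ 𝓑.doc ∧
        (∀ x ∈ (fun q ↦ θ (t, q)) '' W, c ≤ f x → ∃ (γ : ℝ → 𝓑.carrier) (a a' b' : ℝ),
          a' < a ∧ a < 0 ∧ 0 < b' ∧ γ 0 = x ∧ IsMIntegralCurveOn γ Y (Set.Ioo a' b') ∧
          (∀ s ∈ Set.Ioo a' b', γ s ∈ (fun q ↦ θ (t, q)) '' W) ∧ f (γ a) < c) ∧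
        ContMDiffOn (𝓡 4) ((𝓡 4).prod 𝓘(ℝ, E4)) ((⊤ : ℕ∞) : WithTop ℕ∞)
          (fun x ↦ (Bundle.TotalSpace.mk' E4 x
            (VectorField.mpullback (𝓡 4) (𝓡 4) (fun q ↦ θ (-t, q)) K x) :
              TangentBundle (𝓡 4) 𝓑.carrier)) ((fun q ↦ θ (t, q)) '' W) ∧
        (∀ x ∈ (fun q ↦ θ (t, q)) '' W, ∀ v w : TangentSpace (𝓡 4) x,
          𝓑.metric.val x (𝓑.metric.leviCivita
            (VectorField.mpullback (𝓡 4) (𝓡 4) (fun q ↦ θ (-t, q)) K) x v) w +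
            𝓑.metric.val x v (𝓑.metric.leviCivita
              (VectorField.mpullback (𝓡 4) (𝓡 4) (fun q ↦ θ (-t, q)) K) x w) = 0) ∧
        (∀ x ∈ (fun q ↦ θ (t, q)) '' W, VectorField.mlieBracket (𝓡 4) 𝓑.killing
          (VectorField.mpullback (𝓡 4) (𝓡 4) (fun q ↦ θ (-t, q)) K) x = 0) ∧
        ∀ x ∈ (fun q ↦ θ (t, q)) '' W, f x < c →
          VectorField.mpullback (𝓡 4) (𝓡 4) (fun q ↦ θ (-t, q)) K x = L x := by
  intro 𝓑 _ θ f c t Y L K W hθ hθ0 hθadd hθT hiso hdoc hfinv hYinv hLinv hW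
  obtain ⟨hWo, hWdoc, hS, hKs, hKk, hKb, hKL⟩ := hW
  have hθ' : ContMDiff (𝓘(ℝ, ℝ).prod (𝓡 4)) (𝓡 4) ∞ θ := hθ
  have hθ2 : ContMDiff (𝓘(ℝ, ℝ).prod (𝓡 4)) (𝓡 4) 2 θ :=
    hθ'.of_le (ENat.LEInfty.out : (2 : ℕ∞ω) ≤ ∞)
  have hT : ContMDiff (𝓡 4) (𝓡 4).tangent ∞
      (fun x ↦ (⟨x, 𝓑.killing x⟩ : TangentBundle (𝓡 4) 𝓑.carrier)) :=
    𝓑.isStationaryKilling.isKillingField.contMDiff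
  have himg : (fun q ↦ θ (t, q)) '' W = (fun q ↦ θ (-t, q)) ⁻¹' W :=
    image_flow_eq_preimage_flow_neg hθ0 hθadd t W
  have hΦs : ContMDiff (𝓡 4) (𝓡 4) ∞ (fun q : 𝓑.carrier ↦ θ (-t, q)) :=
    hθ'.comp (contMDiff_const.prodMk contMDiff_id)
  have hmem : ∀ y ∈ (fun q ↦ θ (t, q)) '' W, θ (-t, y) ∈ W := fun y hy ↦ by
    rw [himg] at hy; exact hy
  have hdoc' : (fun q ↦ θ (t, q)) '' W ⊆ 𝓑.doc := by
    rintro _ ⟨x, hx, rfl⟩; exact hdoc x (hWdoc hx) t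
  have hKat : ∀ y ∈ (fun q ↦ θ (t, q)) '' W, ContMDiffAt (𝓡 4) ((𝓡 4).prod 𝓘(ℝ, E4)) ∞
      (fun x ↦ (TotalSpace.mk' E4 x (K x) : TangentBundle (𝓡 4) 𝓑.carrier)) (θ (-t, y)) :=
    fun y hy ↦ (hKs _ (hmem y hy)).contMDiffAt (hWo.mem_nhds (hmem y hy))
  refine ⟨?_, hdoc', ?_, ?_, ?_, ?_, ?_⟩
  · rw [himg]
    exact hWo.preimage hΦs.continuous
  · rintro _ ⟨x, hx, rfl⟩ hcx
    have hfx : c ≤ f x := by rwa [hfinv x (hWdoc hx) t] at hcx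
    obtain ⟨γ, a, a', b', ha', ha, hb', hγ0, hγ, hγW, hfa⟩ := hS x hx hfx
    have haI : a ∈ Ioo a' b' := ⟨ha', ha.trans hb'⟩
    refine ⟨(fun q ↦ θ (t, q)) ∘ γ, a, a', b', ha', ha, hb', by simp [hγ0],
      isMIntegralCurveOn_flow_comp hθ2 t (fun p hp ↦ hYinv p hp t) hγ
        (fun s hs ↦ hWdoc (hγW s hs)),
      fun s hs ↦ mem_image_of_mem _ (hγW s hs), ?_⟩
    show f (θ (t, γ a)) < c
    rw [hfinv _ (hWdoc (hγW a haI)) t]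
    exact hfa
  · rw [himg]
    exact ContMDiffOn.mpullback_vectorField_preimage hKs hΦs
      (fun x _ ↦ (inverse_mfderiv_flow_neg hθ2 hθ0 hθadd t x).1) le_rfl
  · intro y hy v w
    exact killing_mpullback_flow_neg 𝓑.metric.toPseudoRiemannianMetric hθ' hθ0 hθadd hiso t
      (hKat y hy) (hKk _ (hmem y hy)) v w
  · intro y hy
    exact mlieBracket_mpullback_flow_neg hT hθ' hθ0 hθadd hθT t (hKat y hy) (hKb _ (hmem y hy))
  · intro y hy hfy
    have hyd : y ∈ 𝓑.doc := hdoc' hy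
    have hfy' : f (θ (-t, y)) < c := by rw [hfinv y hyd (-t)]; exact hfy
    rw [mpullback_flow_neg_apply hθ2 hθ0 hθadd K t y, hKL _ (hmem y hy) hfy',
      hLinv (θ (-t, y)) ⟨hdoc y hyd (-t), hfy'⟩ t]
    rw [flow_apply_flow_neg hθ0 hθadd t y]

end BlackHole

end Summit.FinalStateConjecture.FinalStateConjecture.Theorems.NonTrappingHawkingRigidity.AzimuthalPartialAnalyticity.SlabPatching

end
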